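import Mathlib
import HarnessLib
import Summits.HubbardSuperconductivity.HubbardSuperconductivity.Theorems.KLProgrammeC4aBubblePartition
import Summits.HubbardSuperconductivity.HubbardSuperconductivity.Theorems.KLProgrammeC4aPPKernelSmoothPartition
import Summits.HubbardSuperconductivity.HubbardSuperconductivity.Theorems.KLProgrammeC4aPPKernelSplitFactor
import Summits.HubbardSuperconductivity.HubbardSuperconductivity.Theorems.KLProgrammeC4aCoMovingBridge

/-!
# Route `KLProgramme` — crux C4a, S3 brick (B4) «(U1)-HYBRID», located item #12 «SWAP-PIECE-UMK» answered by «SWAP-BY-SYMMETRY»: with a SYMMETRIC two-line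
# level cut-off the swap piece of the smooth kernel partition `P = A_s + swap A_s + M_s` IS the far piece — `𝐁[χ⊗χ·P] = 2·𝐁[χ⊗χ·A_s] + 𝐁[χ⊗χ·M_s]` — and the
# complement `P·(1 − χ⊗χ)` has the partner level off the Fermi curve after the same swap

Cell `gate-hubbard-kl`, seat hubbard-kl-k3c3-p3 (g38; row «implicit-function / monotonicity route for μ(n)»).  Located brick for the (C)-closer lane / the `M₁`
assembly (stub (C) `stub_twoLeg_curvature` of `KLRegimeEngineV17F2`, stmt-HubbardSuperconductivity-20437), memo HOME/hubbard-kl-k3c3-p3/SWAP-BY-SYMMETRY.md;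
pen (R525)(D) (located #12, default (β) — this file is the (γ′) showing).

WHY.  In the (B3) organisation of record (`…C4aBubblePartition.zoneBox_bubble_eq_three_pieces`: ONE-line level bump on the loop, partner full) the tube pp
piece's kernel family is the full `P(e,·)` and its swap region `m̃ᵤ ≤ (t₁/(1−t₁))·m̃ₑ` (partner at its Fermi level, loop level anywhere in `(Λ, hi]`) is not
empty; there `|∂ᵤP| ≍ 1/(|e|Λ)`, so every envelope row for the swap piece is normalised by `hi/Λ` — not `n`-free on an `n`-free level box.  With a SYMMETRIC
cut-off `χ(e_K q̂)·χ(e_K(S − q̂))` nothing of the kind is needed: the frequency-summed kernel is symmetric (`ppTrueKernel_symm`), the swap piece is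
`A_s` with its arguments exchanged (`ppTrueKernel_eq_farS_add_swap_add_midS`), `M_s` is symmetric (`ppMidKernelS_symm`), and the zone swap `q̂ ↦ S − q̂`
(`setIntegral_zoneBox_comp_sub`) is an identity of the zone integral for EVERY pair momentum `S` — hence of every `θ`-jet of the co-moving reading.
* §1 `zoneBox_swap₂` (the zone swap for a two-argument momentum kernel `G(q̂, S − q̂)`), **`zoneBox_levelKernel_swap`** (`∫ X(e_K q̂, e_K(S−q̂)) = ∫ X(e_K(S−q̂), e_K q̂)`
  for ANY continuous two-level kernel `X`, values in a normed space), `zoneBox_levelKernel_eq_of_swapRel`;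
* §2 **`zoneBox_symmetricCutoff_eq_two_far_add_mid`** (`P = A + Aᵀ + M` pointwise ⟹ `∫ w⊗w·P = 2∫ w⊗w·A + ∫ w⊗w·M`), **`zoneBox_eq_symmetricCutoff_add_complement`**
  (`P` symmetric ⟹ `∫ P = ∫ w⊗w·P + 2∫ w(e)(1 − w(ē))·P + ∫ (1−w)⊗(1−w)·P` — partner level in `supp (1 − w)` in the middle term);
* §3 the same identities as FUNCTIONS OF THE BASE ANGLE at `S = pairSumPath μ K ρ ϑ θ 0` (`zoneBox_symmetricCutoff_pairSum_eq`, `zoneBox_pairSum_eq_symmetricCutoff_add_complement`)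
  and for the `θ`-jets under `ContDiff` of the pieces (`iteratedDeriv_zoneBox_symmetricCutoff_pairSum_eq`);
* §4 the CONCRETE instance: **`zoneBox_ppTrueKernel_symmetricCutoff_eq`** (`P := ppTrueKernel βT Λ`, `A := ppFarKernelS βT Λ κ lo`, `M := ppMidKernelS βT Λ κ lo`,
  any continuous profile `κ`, any `0 < lo`), `zoneBox_ppTrueKernel_eq_symmetricCutoff_add_complement`.
The `CoMovingJetsL1Theta` bookkeeping (dominators of the pp vertex from those of the four symmetric pieces) is the companion `…C4aBubbleSwapSymmetryJets`.
So the umklapp number of `M₁` reads `U = 2·U_A + U_M` over the kernel families `χ·A_s(e,·)`, `χ·M_s(e,·)` (the partner's bump absorbed into the family; row transfer: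
`…C4aKernelBumpRows`), and NO law for the swap piece is ever needed.
Measure-theoretic bookkeeping on landed objects; nothing about the model's sizes; nothing asserts (C), K3, the window or superconductivity.
References: FST II CPAM 51 (1998) §3 [cite: FeldmanSalmhoferTrubowitz1998]; BGM 2006 §2.4 (2.36)/(2.40) [cite: BenfattoGiulianiMastropietro2006].
-/

noncomputable section

namespace Summit.HubbardSuperconductivity.HubbardSuperconductivity.Theorems.C4a

set_option linter.dupNamespace false -- summit = problem name (single-conjunct summit), D-0017

open Real Set Filter MeasureTheory
open scoped Topology ContDiff
open Literature.MathematicalPhysics.QuantumLattice Literature.MathematicalPhysics.QuantumLattice.BandSectorCounting Literature.Probability.LatticeModels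
open Summit.HubbardSuperconductivity.HubbardSuperconductivity.Theorems.KLRegimeSplit
open Summit.HubbardSuperconductivity.HubbardSuperconductivity.Theorems.DispersionFlow
open Summit.HubbardSuperconductivity.HubbardSuperconductivity.Theorems.PerturbedFermiCurve

/-! ## §1 The zone swap for two-argument kernels -/

section Swap

variable {E' : Type*} [NormedAddCommGroup E'] [NormedSpace ℝ E']

/-- **THE ZONE SWAP FOR A TWO-ARGUMENT MOMENTUM KERNEL**: for `G : Momentum → Momentum → E'` jointly continuous and `2π`-periodic in each coordinate of each
argument, `∫_{(−π,π)²} G(q̂, R − q̂) dq = ∫_{(−π,π)²} G(R − q̂, q̂) dq`. [folklore] -/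
theorem zoneBox_swap₂ {G : Momentum → Momentum → E'} (hG : Continuous fun x : Momentum × Momentum => G x.1 x.2)
    (hp₁ : ∀ (j : Fin 2) (a b : Momentum), G (a + EuclideanSpace.single j (2 * π)) b = G a b)
    (hp₂ : ∀ (j : Fin 2) (a b : Momentum), G a (b + EuclideanSpace.single j (2 * π)) = G a b) (R : Momentum) :
    ∫ p in Ioo (-π) π ×ˢ Ioo (-π) π, G (WithLp.toLp 2 ![p.1, p.2]) (R - WithLp.toLp 2 ![p.1, p.2]) =
      ∫ p in Ioo (-π) π ×ˢ Ioo (-π) π, G (R - WithLp.toLp 2 ![p.1, p.2]) (WithLp.toLp 2 ![p.1, p.2]) := by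
  have hn₁ : ∀ (j : Fin 2) (a b : Momentum), G (a - EuclideanSpace.single j (2 * π)) b = G a b := fun j a b => by
    have h := hp₁ j (a - EuclideanSpace.single j (2 * π)) b
    rw [sub_add_cancel] at h
    exact h.symm
  set F : ℝ × ℝ → E' := fun p => G (R - WithLp.toLp 2 ![p.1, p.2]) (WithLp.toLp 2 ![p.1, p.2]) with hFdef
  have hF : Continuous F := hG.comp ((continuous_const.sub continuous_coordToLp).prodMk continuous_coordToLp)
  have h1 : ∀ x y, F (x + 2 * π, y) = F (x, y) := fun x y => by
    simp only [hFdef, toLp_pair_add_two_pi_fst, ← sub_sub, hp₂, hn₁]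
  have h2 : ∀ x y, F (x, y + 2 * π) = F (x, y) := fun x y => by
    simp only [hFdef, toLp_pair_add_two_pi_snd, ← sub_sub, hp₂, hn₁]
  have hswap := setIntegral_zoneBox_comp_sub hF h1 h2 (R 0, R 1)
  have hSF : ∀ p : ℝ × ℝ, F ((R 0, R 1) - p) = G (WithLp.toLp 2 ![p.1, p.2]) (R - WithLp.toLp 2 ![p.1, p.2]) := fun p => by
    have hR : R = WithLp.toLp 2 ![R 0, R 1] := by ext i; fin_cases i <;> simp
    have hc : (WithLp.toLp 2 ![((R 0, R 1) - p).1, ((R 0, R 1) - p).2] : Momentum) = R - WithLp.toLp 2 ![p.1, p.2] := by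
      rw [Prod.fst_sub, Prod.snd_sub, toLp_pair_sub, ← hR]
    simp only [hFdef, hc, sub_sub_cancel]
  simp only [hSF] at hswap
  exact hswap

/-- **THE ZONE SWAP FOR A TWO-LEVEL KERNEL**: for any jointly continuous `X : ℝ → ℝ → E'` and any pair momentum `R`,
`∫_{(−π,π)²} X(e_K q̂, e_K(R − q̂)) dq = ∫_{(−π,π)²} X(e_K(R − q̂), e_K q̂) dq` — loop and partner levels exchanged. [folklore] -/
theorem zoneBox_levelKernel_swap (μ : ℝ) (K : TrigPolyC4v) {X : ℝ → ℝ → E'} (hX : Continuous fun p : ℝ × ℝ => X p.1 p.2) (R : Momentum) :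
    ∫ p in Ioo (-π) π ×ˢ Ioo (-π) π, X (frameLevel μ K (WithLp.toLp 2 ![p.1, p.2])) (frameLevel μ K (R - WithLp.toLp 2 ![p.1, p.2])) =
      ∫ p in Ioo (-π) π ×ˢ Ioo (-π) π, X (frameLevel μ K (R - WithLp.toLp 2 ![p.1, p.2])) (frameLevel μ K (WithLp.toLp 2 ![p.1, p.2])) := by
  have he : Continuous (frameLevel μ K) := (EngineV8.contDiff_frameLevel μ K (n := 0)).continuous
  refine zoneBox_swap₂ (G := fun a b => X (frameLevel μ K a) (frameLevel μ K b)) ?_ ?_ ?_ R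
  · exact hX.comp ((he.comp continuous_fst).prodMk (he.comp continuous_snd))
  · intro j a b; simp only [frameLevel_periodic_single]
  · intro j a b; simp only [frameLevel_periodic_single]

/-- **Swap-related kernels have the same zone integral**: `X(e,u) = Y(u,e)` ⟹ `∫ X(e_K q̂, e_K(R−q̂)) = ∫ Y(e_K q̂, e_K(R−q̂))`. [folklore] -/
theorem zoneBox_levelKernel_eq_of_swapRel (μ : ℝ) (K : TrigPolyC4v) {X Y : ℝ → ℝ → E'} (hX : Continuous fun p : ℝ × ℝ => X p.1 p.2)
    (hXY : ∀ e u, X e u = Y u e) (R : Momentum) :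
    ∫ p in Ioo (-π) π ×ˢ Ioo (-π) π, X (frameLevel μ K (WithLp.toLp 2 ![p.1, p.2])) (frameLevel μ K (R - WithLp.toLp 2 ![p.1, p.2])) =
      ∫ p in Ioo (-π) π ×ˢ Ioo (-π) π, Y (frameLevel μ K (WithLp.toLp 2 ![p.1, p.2])) (frameLevel μ K (R - WithLp.toLp 2 ![p.1, p.2])) := by
  rw [zoneBox_levelKernel_swap μ K hX R]
  simp only [hXY]

end Swap

/-! ## §2 The symmetric organisation of the pp tube piece -/

section Symmetric

variable (μ : ℝ) (K : TrigPolyC4v)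

/-- The level read in zone-box coordinates is continuous. -/
theorem continuous_frameLevel_coord (μ : ℝ) (K : TrigPolyC4v) :
    Continuous fun p : ℝ × ℝ => frameLevel μ K (WithLp.toLp 2 ![p.1, p.2]) :=
  (EngineV8.contDiff_frameLevel μ K (n := 0)).continuous.comp continuous_coordToLp

/-- The partner's level read in zone-box coordinates is continuous. -/
theorem continuous_frameLevel_coord_sub (μ : ℝ) (K : TrigPolyC4v) (R : Momentum) :
    Continuous fun p : ℝ × ℝ => frameLevel μ K (R - WithLp.toLp 2 ![p.1, p.2]) :=
  (EngineV8.contDiff_frameLevel μ K (n := 0)).continuous.comp (continuous_const.sub continuous_coordToLp)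

/-- Integrability of a continuous two-level integrand on the zone box. -/
theorem integrableOn_zoneBox_levelKernel {X : ℝ → ℝ → ℝ} (hX : Continuous fun p : ℝ × ℝ => X p.1 p.2) (R : Momentum) :
    IntegrableOn (fun p : ℝ × ℝ => X (frameLevel μ K (WithLp.toLp 2 ![p.1, p.2])) (frameLevel μ K (R - WithLp.toLp 2 ![p.1, p.2])))
      (Ioo (-π) π ×ˢ Ioo (-π) π) :=
  integrableOn_zoneBox_of_continuous (hX.comp ((continuous_frameLevel_coord μ K).prodMk (continuous_frameLevel_coord_sub μ K R)))

/-- **THE SYMMETRIC ORGANISATION — NO SWAP PIECE**: if `P(e,u) = A(e,u) + A(u,e) + M(e,u)` pointwise (far piece, its swap, comparable-levels piece) then, for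
every continuous level weight `w` and every pair momentum `R`,
`∫ w(e_K q̂)w(e_K(R−q̂))·P(e_K q̂, e_K(R−q̂)) = 2·∫ w(e_K q̂)w(e_K(R−q̂))·A(e_K q̂, e_K(R−q̂)) + ∫ w(e_K q̂)w(e_K(R−q̂))·M(e_K q̂, e_K(R−q̂))`
— the swap piece's zone integral IS the far piece's (`zoneBox_levelKernel_swap` + symmetry of the weight). [folklore] -/
theorem zoneBox_symmetricCutoff_eq_two_far_add_mid {P A M : ℝ → ℝ → ℝ} {w : ℝ → ℝ} (hw : Continuous w)
    (hA : Continuous fun p : ℝ × ℝ => A p.1 p.2) (hM : Continuous fun p : ℝ × ℝ => M p.1 p.2) (hPAM : ∀ e u, P e u = A e u + A u e + M e u)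
    (R : Momentum) :
    ∫ p in Ioo (-π) π ×ˢ Ioo (-π) π, w (frameLevel μ K (WithLp.toLp 2 ![p.1, p.2])) * w (frameLevel μ K (R - WithLp.toLp 2 ![p.1, p.2])) *
        P (frameLevel μ K (WithLp.toLp 2 ![p.1, p.2])) (frameLevel μ K (R - WithLp.toLp 2 ![p.1, p.2])) =
      2 * (∫ p in Ioo (-π) π ×ˢ Ioo (-π) π, w (frameLevel μ K (WithLp.toLp 2 ![p.1, p.2])) * w (frameLevel μ K (R - WithLp.toLp 2 ![p.1, p.2])) *
          A (frameLevel μ K (WithLp.toLp 2 ![p.1, p.2])) (frameLevel μ K (R - WithLp.toLp 2 ![p.1, p.2]))) +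
      ∫ p in Ioo (-π) π ×ˢ Ioo (-π) π, w (frameLevel μ K (WithLp.toLp 2 ![p.1, p.2])) * w (frameLevel μ K (R - WithLp.toLp 2 ![p.1, p.2])) *
          M (frameLevel μ K (WithLp.toLp 2 ![p.1, p.2])) (frameLevel μ K (R - WithLp.toLp 2 ![p.1, p.2])) := by
  have hwA : Continuous fun p : ℝ × ℝ => w p.1 * w p.2 * A p.1 p.2 :=
    ((hw.comp continuous_fst).mul (hw.comp continuous_snd)).mul hA
  have hwAs : Continuous fun p : ℝ × ℝ => w p.1 * w p.2 * A p.2 p.1 :=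
    ((hw.comp continuous_fst).mul (hw.comp continuous_snd)).mul (hA.comp (continuous_snd.prodMk continuous_fst))
  have hwM : Continuous fun p : ℝ × ℝ => w p.1 * w p.2 * M p.1 p.2 :=
    ((hw.comp continuous_fst).mul (hw.comp continuous_snd)).mul hM
  have hIA := integrableOn_zoneBox_levelKernel μ K (X := fun e u => w e * w u * A e u) hwA R
  have hIAs := integrableOn_zoneBox_levelKernel μ K (X := fun e u => w e * w u * A u e) hwAs R
  have hIM := integrableOn_zoneBox_levelKernel μ K (X := fun e u => w e * w u * M e u) hwM R
  -- the swap piece's integral is the far piece's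
  have hsw : ∫ p in Ioo (-π) π ×ˢ Ioo (-π) π, w (frameLevel μ K (WithLp.toLp 2 ![p.1, p.2])) * w (frameLevel μ K (R - WithLp.toLp 2 ![p.1, p.2])) *
        A (frameLevel μ K (R - WithLp.toLp 2 ![p.1, p.2])) (frameLevel μ K (WithLp.toLp 2 ![p.1, p.2])) =
      ∫ p in Ioo (-π) π ×ˢ Ioo (-π) π, w (frameLevel μ K (WithLp.toLp 2 ![p.1, p.2])) * w (frameLevel μ K (R - WithLp.toLp 2 ![p.1, p.2])) *
        A (frameLevel μ K (WithLp.toLp 2 ![p.1, p.2])) (frameLevel μ K (R - WithLp.toLp 2 ![p.1, p.2])) :=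
    zoneBox_levelKernel_eq_of_swapRel μ K (X := fun e u => w e * w u * A u e) (Y := fun e u => w e * w u * A e u) hwAs
      (fun e u => by ring) R
  -- split the integrand
  have hsplit : (fun p : ℝ × ℝ => w (frameLevel μ K (WithLp.toLp 2 ![p.1, p.2])) * w (frameLevel μ K (R - WithLp.toLp 2 ![p.1, p.2])) *
        P (frameLevel μ K (WithLp.toLp 2 ![p.1, p.2])) (frameLevel μ K (R - WithLp.toLp 2 ![p.1, p.2]))) =
      fun p : ℝ × ℝ => (w (frameLevel μ K (WithLp.toLp 2 ![p.1, p.2])) * w (frameLevel μ K (R - WithLp.toLp 2 ![p.1, p.2])) *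
          A (frameLevel μ K (WithLp.toLp 2 ![p.1, p.2])) (frameLevel μ K (R - WithLp.toLp 2 ![p.1, p.2])) +
        w (frameLevel μ K (WithLp.toLp 2 ![p.1, p.2])) * w (frameLevel μ K (R - WithLp.toLp 2 ![p.1, p.2])) *
          A (frameLevel μ K (R - WithLp.toLp 2 ![p.1, p.2])) (frameLevel μ K (WithLp.toLp 2 ![p.1, p.2]))) +
        w (frameLevel μ K (WithLp.toLp 2 ![p.1, p.2])) * w (frameLevel μ K (R - WithLp.toLp 2 ![p.1, p.2])) *
          M (frameLevel μ K (WithLp.toLp 2 ![p.1, p.2])) (frameLevel μ K (R - WithLp.toLp 2 ![p.1, p.2])) := by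
    funext p; rw [hPAM]; ring
  have hI12 : IntegrableOn (fun p : ℝ × ℝ => w (frameLevel μ K (WithLp.toLp 2 ![p.1, p.2])) * w (frameLevel μ K (R - WithLp.toLp 2 ![p.1, p.2])) *
          A (frameLevel μ K (WithLp.toLp 2 ![p.1, p.2])) (frameLevel μ K (R - WithLp.toLp 2 ![p.1, p.2])) +
        w (frameLevel μ K (WithLp.toLp 2 ![p.1, p.2])) * w (frameLevel μ K (R - WithLp.toLp 2 ![p.1, p.2])) *
          A (frameLevel μ K (R - WithLp.toLp 2 ![p.1, p.2])) (frameLevel μ K (WithLp.toLp 2 ![p.1, p.2]))) (Ioo (-π) π ×ˢ Ioo (-π) π) :=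
    hIA.add hIAs
  rw [hsplit, integral_add hI12 hIM, integral_add hIA hIAs, hsw, two_mul]

/-- The pointwise complement split `1 = w(a)w(b) + w(a)(1 − w(b)) + (1 − w(a))w(b) + (1 − w(a))(1 − w(b))`. -/
theorem one_eq_symmetricCutoff_add_complement (w : ℝ → ℝ) (a b : ℝ) :
    (1 : ℝ) = w a * w b + w a * (1 - w b) + (1 - w a) * w b + (1 - w a) * (1 - w b) := by ring

/-- **THE COMPLEMENT OF THE SYMMETRIC CUT-OFF**: for a SYMMETRIC continuous two-level kernel `P` (`P(e,u) = P(u,e)`), a continuous weight `w` and any `R`,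
`∫ P(e_K q̂, e_K(R−q̂)) = ∫ w⊗w·P + 2·∫ w(e_K q̂)(1 − w(e_K(R−q̂)))·P(e_K q̂, e_K(R−q̂)) + ∫ (1 − w)⊗(1 − w)·P` — the loop-far/partner-near piece is the
loop-near/partner-far piece by the swap, so only pieces whose PARTNER level lies in `supp (1 − w)` (off the Fermi curve) or whose both levels do remain. [folklore] -/
theorem zoneBox_eq_symmetricCutoff_add_complement {P : ℝ → ℝ → ℝ} {w : ℝ → ℝ} (hw : Continuous w) (hP : Continuous fun p : ℝ × ℝ => P p.1 p.2)
    (hPsymm : ∀ e u, P e u = P u e) (R : Momentum) :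
    ∫ p in Ioo (-π) π ×ˢ Ioo (-π) π, P (frameLevel μ K (WithLp.toLp 2 ![p.1, p.2])) (frameLevel μ K (R - WithLp.toLp 2 ![p.1, p.2])) =
      (∫ p in Ioo (-π) π ×ˢ Ioo (-π) π, w (frameLevel μ K (WithLp.toLp 2 ![p.1, p.2])) * w (frameLevel μ K (R - WithLp.toLp 2 ![p.1, p.2])) *
          P (frameLevel μ K (WithLp.toLp 2 ![p.1, p.2])) (frameLevel μ K (R - WithLp.toLp 2 ![p.1, p.2]))) +
      2 * (∫ p in Ioo (-π) π ×ˢ Ioo (-π) π, w (frameLevel μ K (WithLp.toLp 2 ![p.1, p.2])) * (1 - w (frameLevel μ K (R - WithLp.toLp 2 ![p.1, p.2]))) *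
          P (frameLevel μ K (WithLp.toLp 2 ![p.1, p.2])) (frameLevel μ K (R - WithLp.toLp 2 ![p.1, p.2]))) +
      ∫ p in Ioo (-π) π ×ˢ Ioo (-π) π, (1 - w (frameLevel μ K (WithLp.toLp 2 ![p.1, p.2]))) * (1 - w (frameLevel μ K (R - WithLp.toLp 2 ![p.1, p.2]))) *
          P (frameLevel μ K (WithLp.toLp 2 ![p.1, p.2])) (frameLevel μ K (R - WithLp.toLp 2 ![p.1, p.2])) := by
  have hw1 : Continuous fun x => 1 - w x := continuous_const.sub hw
  have c1 : Continuous fun p : ℝ × ℝ => w p.1 * w p.2 * P p.1 p.2 := ((hw.comp continuous_fst).mul (hw.comp continuous_snd)).mul hP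
  have c2 : Continuous fun p : ℝ × ℝ => w p.1 * (1 - w p.2) * P p.1 p.2 := ((hw.comp continuous_fst).mul (hw1.comp continuous_snd)).mul hP
  have c3 : Continuous fun p : ℝ × ℝ => (1 - w p.1) * w p.2 * P p.1 p.2 := ((hw1.comp continuous_fst).mul (hw.comp continuous_snd)).mul hP
  have c4 : Continuous fun p : ℝ × ℝ => (1 - w p.1) * (1 - w p.2) * P p.1 p.2 := ((hw1.comp continuous_fst).mul (hw1.comp continuous_snd)).mul hP
  have hI1 := integrableOn_zoneBox_levelKernel μ K (X := fun e u => w e * w u * P e u) c1 R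
  have hI2 := integrableOn_zoneBox_levelKernel μ K (X := fun e u => w e * (1 - w u) * P e u) c2 R
  have hI3 := integrableOn_zoneBox_levelKernel μ K (X := fun e u => (1 - w e) * w u * P e u) c3 R
  have hI4 := integrableOn_zoneBox_levelKernel μ K (X := fun e u => (1 - w e) * (1 - w u) * P e u) c4 R
  -- the loop-far/partner-near piece is the loop-near/partner-far one
  have hsw : ∫ p in Ioo (-π) π ×ˢ Ioo (-π) π, (1 - w (frameLevel μ K (WithLp.toLp 2 ![p.1, p.2]))) * w (frameLevel μ K (R - WithLp.toLp 2 ![p.1, p.2])) *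
        P (frameLevel μ K (WithLp.toLp 2 ![p.1, p.2])) (frameLevel μ K (R - WithLp.toLp 2 ![p.1, p.2])) =
      ∫ p in Ioo (-π) π ×ˢ Ioo (-π) π, w (frameLevel μ K (WithLp.toLp 2 ![p.1, p.2])) * (1 - w (frameLevel μ K (R - WithLp.toLp 2 ![p.1, p.2]))) *
        P (frameLevel μ K (WithLp.toLp 2 ![p.1, p.2])) (frameLevel μ K (R - WithLp.toLp 2 ![p.1, p.2])) :=
    zoneBox_levelKernel_eq_of_swapRel μ K (X := fun e u => (1 - w e) * w u * P e u) (Y := fun e u => w e * (1 - w u) * P e u) c3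
      (fun e u => by rw [hPsymm e u]; ring) R
  have hsplit : (fun p : ℝ × ℝ => P (frameLevel μ K (WithLp.toLp 2 ![p.1, p.2])) (frameLevel μ K (R - WithLp.toLp 2 ![p.1, p.2]))) =
      fun p : ℝ × ℝ =>
        ((w (frameLevel μ K (WithLp.toLp 2 ![p.1, p.2])) * w (frameLevel μ K (R - WithLp.toLp 2 ![p.1, p.2])) *
            P (frameLevel μ K (WithLp.toLp 2 ![p.1, p.2])) (frameLevel μ K (R - WithLp.toLp 2 ![p.1, p.2])) +
          w (frameLevel μ K (WithLp.toLp 2 ![p.1, p.2])) * (1 - w (frameLevel μ K (R - WithLp.toLp 2 ![p.1, p.2]))) *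
            P (frameLevel μ K (WithLp.toLp 2 ![p.1, p.2])) (frameLevel μ K (R - WithLp.toLp 2 ![p.1, p.2]))) +
          (1 - w (frameLevel μ K (WithLp.toLp 2 ![p.1, p.2]))) * w (frameLevel μ K (R - WithLp.toLp 2 ![p.1, p.2])) *
            P (frameLevel μ K (WithLp.toLp 2 ![p.1, p.2])) (frameLevel μ K (R - WithLp.toLp 2 ![p.1, p.2]))) +
        (1 - w (frameLevel μ K (WithLp.toLp 2 ![p.1, p.2]))) * (1 - w (frameLevel μ K (R - WithLp.toLp 2 ![p.1, p.2]))) *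
          P (frameLevel μ K (WithLp.toLp 2 ![p.1, p.2])) (frameLevel μ K (R - WithLp.toLp 2 ![p.1, p.2])) := by
    funext p; ring
  have hI12 : IntegrableOn (fun p : ℝ × ℝ =>
      w (frameLevel μ K (WithLp.toLp 2 ![p.1, p.2])) * w (frameLevel μ K (R - WithLp.toLp 2 ![p.1, p.2])) *
          P (frameLevel μ K (WithLp.toLp 2 ![p.1, p.2])) (frameLevel μ K (R - WithLp.toLp 2 ![p.1, p.2])) +
        w (frameLevel μ K (WithLp.toLp 2 ![p.1, p.2])) * (1 - w (frameLevel μ K (R - WithLp.toLp 2 ![p.1, p.2]))) *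
          P (frameLevel μ K (WithLp.toLp 2 ![p.1, p.2])) (frameLevel μ K (R - WithLp.toLp 2 ![p.1, p.2]))) (Ioo (-π) π ×ˢ Ioo (-π) π) :=
    hI1.add hI2
  have hI123 : IntegrableOn (fun p : ℝ × ℝ =>
      (w (frameLevel μ K (WithLp.toLp 2 ![p.1, p.2])) * w (frameLevel μ K (R - WithLp.toLp 2 ![p.1, p.2])) *
            P (frameLevel μ K (WithLp.toLp 2 ![p.1, p.2])) (frameLevel μ K (R - WithLp.toLp 2 ![p.1, p.2])) +
          w (frameLevel μ K (WithLp.toLp 2 ![p.1, p.2])) * (1 - w (frameLevel μ K (R - WithLp.toLp 2 ![p.1, p.2]))) *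
            P (frameLevel μ K (WithLp.toLp 2 ![p.1, p.2])) (frameLevel μ K (R - WithLp.toLp 2 ![p.1, p.2]))) +
        (1 - w (frameLevel μ K (WithLp.toLp 2 ![p.1, p.2]))) * w (frameLevel μ K (R - WithLp.toLp 2 ![p.1, p.2])) *
          P (frameLevel μ K (WithLp.toLp 2 ![p.1, p.2])) (frameLevel μ K (R - WithLp.toLp 2 ![p.1, p.2]))) (Ioo (-π) π ×ˢ Ioo (-π) π) :=
    hI12.add hI3
  rw [hsplit, integral_add hI123 hI4, integral_add hI12 hI3, integral_add hI1 hI2, hsw]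
  ring

end Symmetric

/-! ## §3 At the co-moving pair momentum: the identities as functions of the base angle, and their jets -/

section BaseAngle

variable (μ : ℝ) (K : TrigPolyC4v)

/-- **The symmetric organisation along the pair-sum path** (functions of `θ`): with `S(θ) = pairSumPath μ K ρ ϑ θ 0`,
`(θ ↦ ∫ w⊗w·P at S(θ)) = (θ ↦ 2·∫ w⊗w·A at S(θ) + ∫ w⊗w·M at S(θ))`. -/
theorem zoneBox_symmetricCutoff_pairSum_eq {P A M : ℝ → ℝ → ℝ} {w : ℝ → ℝ} (hw : Continuous w)
    (hA : Continuous fun p : ℝ × ℝ => A p.1 p.2) (hM : Continuous fun p : ℝ × ℝ => M p.1 p.2) (hPAM : ∀ e u, P e u = A e u + A u e + M e u)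
    (ρ ϑ : ℝ) :
    (fun θ : ℝ => ∫ p in Ioo (-π) π ×ˢ Ioo (-π) π, w (frameLevel μ K (WithLp.toLp 2 ![p.1, p.2])) *
        w (frameLevel μ K (pairSumPath μ K ρ ϑ θ 0 - WithLp.toLp 2 ![p.1, p.2])) *
        P (frameLevel μ K (WithLp.toLp 2 ![p.1, p.2])) (frameLevel μ K (pairSumPath μ K ρ ϑ θ 0 - WithLp.toLp 2 ![p.1, p.2]))) =
      fun θ : ℝ => 2 * (∫ p in Ioo (-π) π ×ˢ Ioo (-π) π, w (frameLevel μ K (WithLp.toLp 2 ![p.1, p.2])) *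
          w (frameLevel μ K (pairSumPath μ K ρ ϑ θ 0 - WithLp.toLp 2 ![p.1, p.2])) *
          A (frameLevel μ K (WithLp.toLp 2 ![p.1, p.2])) (frameLevel μ K (pairSumPath μ K ρ ϑ θ 0 - WithLp.toLp 2 ![p.1, p.2]))) +
        ∫ p in Ioo (-π) π ×ˢ Ioo (-π) π, w (frameLevel μ K (WithLp.toLp 2 ![p.1, p.2])) *
          w (frameLevel μ K (pairSumPath μ K ρ ϑ θ 0 - WithLp.toLp 2 ![p.1, p.2])) *
          M (frameLevel μ K (WithLp.toLp 2 ![p.1, p.2])) (frameLevel μ K (pairSumPath μ K ρ ϑ θ 0 - WithLp.toLp 2 ![p.1, p.2])) := by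
  funext θ
  exact zoneBox_symmetricCutoff_eq_two_far_add_mid μ K hw hA hM hPAM _

/-- **The complement split along the pair-sum path** (functions of `θ`). -/
theorem zoneBox_pairSum_eq_symmetricCutoff_add_complement {P : ℝ → ℝ → ℝ} {w : ℝ → ℝ} (hw : Continuous w)
    (hP : Continuous fun p : ℝ × ℝ => P p.1 p.2) (hPsymm : ∀ e u, P e u = P u e) (ρ ϑ : ℝ) :
    (fun θ : ℝ => ∫ p in Ioo (-π) π ×ˢ Ioo (-π) π,
        P (frameLevel μ K (WithLp.toLp 2 ![p.1, p.2])) (frameLevel μ K (pairSumPath μ K ρ ϑ θ 0 - WithLp.toLp 2 ![p.1, p.2]))) =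
      fun θ : ℝ =>
        (∫ p in Ioo (-π) π ×ˢ Ioo (-π) π, w (frameLevel μ K (WithLp.toLp 2 ![p.1, p.2])) *
            w (frameLevel μ K (pairSumPath μ K ρ ϑ θ 0 - WithLp.toLp 2 ![p.1, p.2])) *
            P (frameLevel μ K (WithLp.toLp 2 ![p.1, p.2])) (frameLevel μ K (pairSumPath μ K ρ ϑ θ 0 - WithLp.toLp 2 ![p.1, p.2]))) +
        2 * (∫ p in Ioo (-π) π ×ˢ Ioo (-π) π, w (frameLevel μ K (WithLp.toLp 2 ![p.1, p.2])) *
            (1 - w (frameLevel μ K (pairSumPath μ K ρ ϑ θ 0 - WithLp.toLp 2 ![p.1, p.2]))) *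
            P (frameLevel μ K (WithLp.toLp 2 ![p.1, p.2])) (frameLevel μ K (pairSumPath μ K ρ ϑ θ 0 - WithLp.toLp 2 ![p.1, p.2]))) +
        ∫ p in Ioo (-π) π ×ˢ Ioo (-π) π, (1 - w (frameLevel μ K (WithLp.toLp 2 ![p.1, p.2]))) *
            (1 - w (frameLevel μ K (pairSumPath μ K ρ ϑ θ 0 - WithLp.toLp 2 ![p.1, p.2]))) *
            P (frameLevel μ K (WithLp.toLp 2 ![p.1, p.2])) (frameLevel μ K (pairSumPath μ K ρ ϑ θ 0 - WithLp.toLp 2 ![p.1, p.2])) := by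
  funext θ
  exact zoneBox_eq_symmetricCutoff_add_complement μ K hw hP hPsymm _

/-- **The θ-JETS of the symmetric organisation**: if the far and comparable pieces' zone integrals are `C^k` in the base angle, every jet of the `P`-piece
is `2·(jet of the A-piece) + (jet of the M-piece)`. -/
theorem iteratedDeriv_zoneBox_symmetricCutoff_pairSum_eq {P A M : ℝ → ℝ → ℝ} {w : ℝ → ℝ} (hw : Continuous w)
    (hA : Continuous fun p : ℝ × ℝ => A p.1 p.2) (hM : Continuous fun p : ℝ × ℝ => M p.1 p.2) (hPAM : ∀ e u, P e u = A e u + A u e + M e u)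
    (ρ ϑ : ℝ) {k : ℕ}
    (hAk : ContDiff ℝ k fun θ : ℝ => ∫ p in Ioo (-π) π ×ˢ Ioo (-π) π, w (frameLevel μ K (WithLp.toLp 2 ![p.1, p.2])) *
        w (frameLevel μ K (pairSumPath μ K ρ ϑ θ 0 - WithLp.toLp 2 ![p.1, p.2])) *
        A (frameLevel μ K (WithLp.toLp 2 ![p.1, p.2])) (frameLevel μ K (pairSumPath μ K ρ ϑ θ 0 - WithLp.toLp 2 ![p.1, p.2])))
    (hMk : ContDiff ℝ k fun θ : ℝ => ∫ p in Ioo (-π) π ×ˢ Ioo (-π) π, w (frameLevel μ K (WithLp.toLp 2 ![p.1, p.2])) *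
        w (frameLevel μ K (pairSumPath μ K ρ ϑ θ 0 - WithLp.toLp 2 ![p.1, p.2])) *
        M (frameLevel μ K (WithLp.toLp 2 ![p.1, p.2])) (frameLevel μ K (pairSumPath μ K ρ ϑ θ 0 - WithLp.toLp 2 ![p.1, p.2])))
    (θ : ℝ) :
    iteratedDeriv k (fun θ : ℝ => ∫ p in Ioo (-π) π ×ˢ Ioo (-π) π, w (frameLevel μ K (WithLp.toLp 2 ![p.1, p.2])) *
        w (frameLevel μ K (pairSumPath μ K ρ ϑ θ 0 - WithLp.toLp 2 ![p.1, p.2])) *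
        P (frameLevel μ K (WithLp.toLp 2 ![p.1, p.2])) (frameLevel μ K (pairSumPath μ K ρ ϑ θ 0 - WithLp.toLp 2 ![p.1, p.2]))) θ =
      2 * iteratedDeriv k (fun θ : ℝ => ∫ p in Ioo (-π) π ×ˢ Ioo (-π) π, w (frameLevel μ K (WithLp.toLp 2 ![p.1, p.2])) *
          w (frameLevel μ K (pairSumPath μ K ρ ϑ θ 0 - WithLp.toLp 2 ![p.1, p.2])) *
          A (frameLevel μ K (WithLp.toLp 2 ![p.1, p.2])) (frameLevel μ K (pairSumPath μ K ρ ϑ θ 0 - WithLp.toLp 2 ![p.1, p.2]))) θ +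
        iteratedDeriv k (fun θ : ℝ => ∫ p in Ioo (-π) π ×ˢ Ioo (-π) π, w (frameLevel μ K (WithLp.toLp 2 ![p.1, p.2])) *
          w (frameLevel μ K (pairSumPath μ K ρ ϑ θ 0 - WithLp.toLp 2 ![p.1, p.2])) *
          M (frameLevel μ K (WithLp.toLp 2 ![p.1, p.2])) (frameLevel μ K (pairSumPath μ K ρ ϑ θ 0 - WithLp.toLp 2 ![p.1, p.2]))) θ := by
  rw [zoneBox_symmetricCutoff_pairSum_eq μ K hw hA hM hPAM ρ ϑ]
  have h2A : ContDiff ℝ k fun θ : ℝ => 2 * ∫ p in Ioo (-π) π ×ˢ Ioo (-π) π, w (frameLevel μ K (WithLp.toLp 2 ![p.1, p.2])) *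
        w (frameLevel μ K (pairSumPath μ K ρ ϑ θ 0 - WithLp.toLp 2 ![p.1, p.2])) *
        A (frameLevel μ K (WithLp.toLp 2 ![p.1, p.2])) (frameLevel μ K (pairSumPath μ K ρ ϑ θ 0 - WithLp.toLp 2 ![p.1, p.2])) :=
    contDiff_const.mul hAk
  rw [iteratedDeriv_fun_add h2A.contDiffAt hMk.contDiffAt, iteratedDeriv_const_mul_field]

end BaseAngle

/-! ## §4 The concrete kernel: `P = ppTrueKernel`, `A = ppFarKernelS`, `M = ppMidKernelS` -/

section Concrete

variable (μ : ℝ) (K : TrigPolyC4v) {βT Λ : ℝ} (hβ : 0 < βT) (κ : ℝ → ℝ) (hκ : Continuous κ) {lo : ℝ} (hlo : 0 < lo)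
include hβ hκ hlo

/-- Joint continuity of the smooth far piece `A_s`. -/
theorem continuous_ppFarKernelS₂ : Continuous fun p : ℝ × ℝ => ppFarKernelS βT Λ κ lo p.1 p.2 := by
  unfold ppFarKernelS
  exact (continuous_ppTrueKernel_comp hβ Λ continuous_fst continuous_snd).mul (hκ.comp (continuous_ppSmoothRatio₂ hlo))

/-- Joint continuity of the smooth comparable-levels piece `M_s`. -/
theorem continuous_ppMidKernelS₂ : Continuous fun p : ℝ × ℝ => ppMidKernelS βT Λ κ lo p.1 p.2 := by
  unfold ppMidKernelS
  refine (continuous_ppTrueKernel_comp hβ Λ continuous_fst continuous_snd).mul ?_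
  exact (continuous_const.sub (hκ.comp (continuous_ppSmoothRatio₂ hlo))).sub
    (hκ.comp (continuous_const.sub (continuous_ppSmoothRatio₂ hlo)))

/-- **THE TRUE pp KERNEL UNDER A SYMMETRIC CUT-OFF — NO SWAP PIECE** (located #12): for every continuous level weight `w`, every continuous split profile
`κ`, every smooth floor `0 < lo` and every pair momentum `R`,
`∫ w⊗w·P(e_K q̂, e_K(R−q̂)) = 2·∫ w⊗w·A_s(e_K q̂, e_K(R−q̂)) + ∫ w⊗w·M_s(e_K q̂, e_K(R−q̂))`
(`P = ppTrueKernel βT Λ`, `A_s = ppFarKernelS βT Λ κ lo`, `M_s = ppMidKernelS βT Λ κ lo`). [cite: BenfattoGiulianiMastropietro2006, §2.4 (2.36)] -/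
theorem zoneBox_ppTrueKernel_symmetricCutoff_eq {w : ℝ → ℝ} (hw : Continuous w) (R : Momentum) :
    ∫ p in Ioo (-π) π ×ˢ Ioo (-π) π, w (frameLevel μ K (WithLp.toLp 2 ![p.1, p.2])) * w (frameLevel μ K (R - WithLp.toLp 2 ![p.1, p.2])) *
        ppTrueKernel βT Λ (frameLevel μ K (WithLp.toLp 2 ![p.1, p.2])) (frameLevel μ K (R - WithLp.toLp 2 ![p.1, p.2])) =
      2 * (∫ p in Ioo (-π) π ×ˢ Ioo (-π) π, w (frameLevel μ K (WithLp.toLp 2 ![p.1, p.2])) * w (frameLevel μ K (R - WithLp.toLp 2 ![p.1, p.2])) *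
          ppFarKernelS βT Λ κ lo (frameLevel μ K (WithLp.toLp 2 ![p.1, p.2])) (frameLevel μ K (R - WithLp.toLp 2 ![p.1, p.2]))) +
      ∫ p in Ioo (-π) π ×ˢ Ioo (-π) π, w (frameLevel μ K (WithLp.toLp 2 ![p.1, p.2])) * w (frameLevel μ K (R - WithLp.toLp 2 ![p.1, p.2])) *
          ppMidKernelS βT Λ κ lo (frameLevel μ K (WithLp.toLp 2 ![p.1, p.2])) (frameLevel μ K (R - WithLp.toLp 2 ![p.1, p.2])) :=
  zoneBox_symmetricCutoff_eq_two_far_add_mid μ K hw (continuous_ppFarKernelS₂ hβ κ hκ hlo) (continuous_ppMidKernelS₂ hβ κ hκ hlo)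
    (fun e u => ppTrueKernel_eq_farS_add_swap_add_midS κ hlo e u) R

omit hκ hlo in
/-- **THE TRUE pp KERNEL: SYMMETRIC CUT-OFF + COMPLEMENT**:
`∫ P = ∫ w⊗w·P + 2·∫ w(e_K q̂)(1 − w(e_K(R−q̂)))·P + ∫ (1−w)⊗(1−w)·P` (`P = ppTrueKernel βT Λ` is symmetric). [cite: BenfattoGiulianiMastropietro2006, §2.4 (2.36)] -/
theorem zoneBox_ppTrueKernel_eq_symmetricCutoff_add_complement {w : ℝ → ℝ} (hw : Continuous w) (R : Momentum) :
    ∫ p in Ioo (-π) π ×ˢ Ioo (-π) π,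
        ppTrueKernel βT Λ (frameLevel μ K (WithLp.toLp 2 ![p.1, p.2])) (frameLevel μ K (R - WithLp.toLp 2 ![p.1, p.2])) =
      (∫ p in Ioo (-π) π ×ˢ Ioo (-π) π, w (frameLevel μ K (WithLp.toLp 2 ![p.1, p.2])) * w (frameLevel μ K (R - WithLp.toLp 2 ![p.1, p.2])) *
          ppTrueKernel βT Λ (frameLevel μ K (WithLp.toLp 2 ![p.1, p.2])) (frameLevel μ K (R - WithLp.toLp 2 ![p.1, p.2]))) +
      2 * (∫ p in Ioo (-π) π ×ˢ Ioo (-π) π, w (frameLevel μ K (WithLp.toLp 2 ![p.1, p.2])) * (1 - w (frameLevel μ K (R - WithLp.toLp 2 ![p.1, p.2]))) *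
          ppTrueKernel βT Λ (frameLevel μ K (WithLp.toLp 2 ![p.1, p.2])) (frameLevel μ K (R - WithLp.toLp 2 ![p.1, p.2]))) +
      ∫ p in Ioo (-π) π ×ˢ Ioo (-π) π, (1 - w (frameLevel μ K (WithLp.toLp 2 ![p.1, p.2]))) * (1 - w (frameLevel μ K (R - WithLp.toLp 2 ![p.1, p.2]))) *
          ppTrueKernel βT Λ (frameLevel μ K (WithLp.toLp 2 ![p.1, p.2])) (frameLevel μ K (R - WithLp.toLp 2 ![p.1, p.2])) :=
  zoneBox_eq_symmetricCutoff_add_complement μ K hw (continuous_ppTrueKernel_comp hβ Λ continuous_fst continuous_snd)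
    (fun e u => ppTrueKernel_symm βT Λ e u) R

end Concrete

end Summit.HubbardSuperconductivity.HubbardSuperconductivity.Theorems.C4a

end
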